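import Summits.BirchSwinnertonDyer.Rank1Residual.Additive.GordDescentFreeField
import Summits.BirchSwinnertonDyer.Rank1Residual.AdditivePotMult.NonvanishingTwist
import HarnessLib

/-!
# X3♯(G-ord), defect 2: a NON-ANOMALOUS rank-zero twist always exists — the X1 input of the twist pair is no longer needed

HONEST FRAMING (cell `b2b-bsdres`, run/shared/lean/b2b/bsd-rank1-residual/, verbatim in every
file): the goal of the cell is to DELETE the COMBINATION-SHAPED residual classes of the
Birch–Swinnerton-Dyer formula for ALL analytic-rank `≤ 1` elliptic curves over `ℚ` — "full BSD
formula for every rank `≤ 1` curve in class `C`" assembled STRICTLY from published theorems — so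
that the rank-`≤ 1` remainder becomes exactly the CONSTRUCTION-SHAPED classes, which are TYPED
(missing-input `Prop`s), NOT attempted. This is not "finishing BSD". Sub-cell `additive-p2`
(CLASS-OWNERS row "X3/X4 additive — pot. good ordinary / X3♯(G-ord)"), generation 6: research
route; no claim beyond the stated classes; theorems only, no definition, no new named fact;
X3♯(G-ord)/X4♯(G-ord) stay CONSTRUCTION-SHAPED.

WHAT THIS FILE DOES. Gens 2/4 relocated `BSD(E,p)` for `(E,p) ∈ X3♯(G-ord) ∩ I₀*` (Eisenstein
additive `p ≥ 5`, Kodaira `I₀*`) onto the over-`K` input over `K = ℚ(√p*)` PLUS — whenever the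
twist pair `(E^{(p*)}, p)` is a class-X1 pair (anomalous Eisenstein good prime off the
Greenberg–Vatsal cell) — the cell's typed X1 input of the twist (`bsdp_of_classX3Gord_two_cases`;
census `TWIST-CENSUS.md`: 243 of the 301 X3 `I₀*` pairs at N < 2·10⁴ have an X1 twist pair). With
the descent field FREE (`GordDescentFreeField.lean`) the X1 branch disappears: the anomaly of the
twist can always be switched off.

* `exists_twist_goodOrd_frobeniusTrace` — one twisting step at an odd good ordinary `p` by a
  square-free `d` with `p ∤ d`: a globally minimal `W₂ ≅ W₁^{(d)}`, good ORDINARY at `p`, with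
  `a_p(W₂) = (d/p)·a_p(W₁)` (tree `isOrdinaryAt_of_smul_eq_quadraticTwist`,
  `frobeniusTrace_quadraticTwist_holds`; Knapp Prop. 12.10); `exists_model_twist_mul` (models of
  iterated twists);
* **`exists_goodOrd_rankZero_nonAnom_twist_of_typeGOrd`** — for every (G)-ordinary defect-2 pair
  (`p ≥ 5`) there are a square-free `d' ≡ 1 (mod 8)`, `p ∤ d'`, and a globally minimal
  `Wd ≅ E^{(p*·d')}` that is GOOD ORDINARY at `p`, of ANALYTIC RANK `0`, and NOT ANOMALOUS
  (`a_p(Wd) ≢ 1 (mod p)`). If `a_p(E^{(p*)}) ≢ 1`: Hoffstein–Luo with `S = {p}` (`(d'/p) = 1`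
  keeps `a_p`). If `a_p(E^{(p*)}) ≡ 1`: an auxiliary prime `u ≡ 1 (mod 8)` with `(p/u) = −1`
  (additive-p1's `exists_prime_one_mod_eight_jacobiSym_eq`; reciprocity gives `(u/p) = −1`, so
  `a_p ↦ −a_p ≡ −1 ≢ 1` as `p > 2`), then Hoffstein–Luo for `E^{(p*·u)}` with `S = {p, u}`;
* **`bsdp_of_classX3Gord_two_of_forall_ramified`** — `(E,p) ∈ X3♯(G-ord)`, `e_E(p) = 2`, `p ≥ 5`,
  `r_an(E) ≤ 1`: **`BSD(E,p)` follows from `MissingPPartOverCAt (W.baseChange K) p` granted for every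
  quadratic `K` with `p ∣ d_K`** (+ published binders: Castella–Grossi–Skinner 2025 Thm. D with the
  Greenberg–Vatsal / Greenberg / Kato chain = row C6, GZK, modularity, Milne 1972 any-model,
  Hoffstein–Luo 1997) — for EVERY pair of the sub-class, with NO X1 input and NO twist datum;
  `…_of_forall_quadratic`, `missingPPartAt_of_classX3Gord_two_of_forall_ramified`;
* `bsdp_iff_overC_of_classX3_of_nonAnom_twist`, `ClassX3Gord.exists_quadraticField_bsdp_iff` —
  exactness survives: every pair has a quadratic `K` ramified at `p` with
  `BSD(E,p) ⟺ MissingPPartOverCAt (W.baseChange K) p`.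

NET (gen 6, with `GordDescentFreeField.lean`): on the whole defect-2 (`I₀*`) cell at `p ≥ 5` —
X3♯(G-ord) entirely, X4♯(G-ord) on its surjective-image rows — the residue is ONE uniform typed
statement, "the `p`-part of BSD for `E` over the quadratic fields ramified at `p`" (where `E_K` is
GOOD ORDINARY at the ramified prime, `GordDescentField.lean`), exactly as for additive-p1's
potentially multiplicative classes. It is printed nowhere (Wan 2015 §1.1 / BCS 2025 §2.1 (ur);
BDP / JSW `p` split; W. Zhang 2014 `p ∤ D_K N`); labels, census, located gap UNCHANGED
(HOME/b2b-bsdres-additive-p2/AUDIT-X34-GORD.md).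

References: J. Hoffstein, W. Luo, Math. Res. Lett. 4 (1997) 435–442, Theorem; F. Castella,
G. Grossi, C. Skinner (2025), Thm. D; R. Greenberg, V. Vatsal, Invent. Math. 142 (2000) Thm. 1.3;
A. W. Knapp, *Elliptic Curves*, Prop. 12.10; J. S. Milne, Invent. Math. 17 (1972); K. Ireland,
M. Rosen, *A Classical Introduction to Modern Number Theory*, Prop. 5.2.2 (reciprocity);
D. Delbourgo, Compositio Math. 113 (1998) §1.5.
-/

noncomputable section

open scoped Classical NumberField

open WeierstrassCurve IsDedekindDomain NumberField Literature.NumberTheory.EllipticCurves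
  Literature.NumberTheory.EllipticCurves.Rank1Residual
  Literature.NumberTheory.EllipticCurves.Rank1Residual.Typed
  Literature.NumberTheory.EllipticCurves.ModularForms
  Literature.NumberTheory.EllipticCurves.Wuthrich2014
  Summit.BirchSwinnertonDyer.Rank1Residual.AdditivePotMult

namespace Summit.BirchSwinnertonDyer.Rank1Residual.Additive

variable (W : WeierstrassCurve ℚ) [W.IsElliptic] [W.IsGloballyMinimal] (p : ℕ) [hp : Fact p.Prime]

/-! ### One twisting step: model, good ordinary reduction, trace of Frobenius -/

section Step

variable (W₁ : WeierstrassCurve ℚ) [W₁.IsElliptic] [W₁.IsGloballyMinimal]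

omit W in
/-- **One unramified-at-`p` twisting step.** For `W₁/ℚ` globally minimal, good ordinary at an odd
`p`, and a square-free `d` with `p ∤ d`: a globally minimal `W₂ ≅ W₁^{(d)}` exists, is good ORDINARY
at `p` (tree `isOrdinaryAt_of_smul_eq_quadraticTwist`), and `a_p(W₂) = (d/p)·a_p(W₁)` (tree
fact-theorem `frobeniusTrace_quadraticTwist_holds`, Knapp Prop. 12.10). [cite: Knapp1993, Prop. 12.10] -/
theorem exists_twist_goodOrd_frobeniusTrace (hp2 : p ≠ 2) (hord : GoodOrd W₁ p) {d : ℤ}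
    (hsq : Squarefree d) (hpd : ¬ (p : ℤ) ∣ d) :
    ∃ (W₂ : WeierstrassCurve ℚ) (_ : W₂.IsElliptic) (_ : W₂.IsGloballyMinimal),
      (∃ C : VariableChange ℚ, C • W₁.quadraticTwist (d : ℚ) = W₂) ∧ GoodOrd W₂ p ∧
        W₂.frobeniusTrace p = legendreSym p d * W₁.frobeniusTrace p := by
  have hd0 : ((d : ℤ) : ℚ) ≠ 0 := by exact_mod_cast hsq.ne_zero
  obtain ⟨W₂, iW₂, iW₂m, C, hC⟩ := exists_isGloballyMinimal_smul_eq_quadraticTwist W₁ hd0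
  have hordd : IsOrdinaryAt W₂ p :=
    isOrdinaryAt_of_smul_eq_quadraticTwist W₁ W₂ hsq hC p hp2 hpd ⟨hord.1, hord.2⟩
  have hpZ : Prime (p : ℤ) := Nat.prime_iff_prime_int.mp hp.out
  have hp2' : ¬ (p : ℤ) ∣ 2 := fun h =>
    hp2 ((Nat.prime_dvd_prime_iff_eq hp.out Nat.prime_two).mp (Int.natCast_dvd_natCast.mp h))
  have hp2d : ¬ (p : ℤ) ∣ 2 * d := fun h => (hpZ.dvd_or_dvd h).elim hp2' hpd
  have hΔ : ¬ (p : ℤ) ∣ W₁.minimalDiscriminantInt :=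
    W₁.not_dvd_minimalDiscriminantInt_of_hasGoodReductionAtPrime' p hord.1
  have htr := frobeniusTrace_quadraticTwist_holds W₁ W₂ d hsq ⟨C, hC⟩ p hp2d hΔ
  exact ⟨W₂, iW₂, iW₂m, ⟨C⁻¹, by rw [← hC, inv_smul_smul]⟩, ⟨hordd.1, hordd.2⟩, htr⟩

omit [W.IsElliptic] [W.IsGloballyMinimal] hp in
/-- Composition of twists on models: `C₁ • W^{(d₁)} = W₁` and `C₂ • W₁^{(d₂)} = W₂` give
`C • W^{(d₁ d₂)} = W₂` (`quadraticTwist_smul`, `quadraticTwist_quadraticTwist`). -/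
theorem exists_model_twist_mul {d₁ d₂ : ℚ} {W₁ W₂ : WeierstrassCurve ℚ}
    (h₁ : ∃ C : VariableChange ℚ, C • W.quadraticTwist d₁ = W₁)
    (h₂ : ∃ C : VariableChange ℚ, C • W₁.quadraticTwist d₂ = W₂) :
    ∃ C : VariableChange ℚ, C • W.quadraticTwist (d₁ * d₂) = W₂ := by
  obtain ⟨C₁, rfl⟩ := h₁
  obtain ⟨C₂, rfl⟩ := h₂
  exact ⟨C₂ * ⟨C₁.u, d₂ * C₁.r, 0, 0⟩, by
    rw [quadraticTwist_smul, quadraticTwist_quadraticTwist, mul_smul]⟩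

end Step

/-! ### Supply: a good ordinary, rank-zero, NON-ANOMALOUS twist by `p*·d'`, `p ∤ d'` -/

section Supply

/-- `(u/p) = −1` for a prime `u ≡ 1 (mod 4)` with `(p/u) = −1` (quadratic reciprocity). -/
private theorem legendreSym_eq_neg_one_of_jacobiSym {u : ℕ} (hu4 : u % 4 = 1) (hp2 : p ≠ 2)
    (hJ : jacobiSym (p : ℤ) u = -1) : legendreSym p u = -1 := by
  have hpodd : Odd p := hp.out.odd_of_ne_two hp2
  rw [jacobiSym.legendreSym.to_jacobiSym, jacobiSym.quadratic_reciprocity_one_mod_four hu4 hpodd, hJ]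

/-- **Every (G)-ordinary defect-2 pair has a GOOD ORDINARY, NON-ANOMALOUS quadratic twist of
ANALYTIC RANK ZERO by a discriminant `p*·d'`, `p ∤ d'`** (`p ≥ 5`, `W` globally minimal;
Hoffstein–Luo 1997 `hHL`). Let `E₁ = E^{(p*)}` (good ordinary at `p`, gen 4) and `a = a_p(E₁)`.
If `a ≢ 1 (mod p)`: Hoffstein–Luo with `S = {p}` gives `d'` with `(d'/p) = 1` and
`L(E₁^{(d')}, 1) ≠ 0`, and `a_p(E₁^{(d')}) = a`. If `a ≡ 1 (mod p)`: first twist by a prime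
`u ≡ 1 (mod 8)` with `(p/u) = −1` (Dirichlet + CRT, additive-p1's
`exists_prime_one_mod_eight_jacobiSym_eq`), so `(u/p) = −1` and `a_p(E₁^{(u)}) = −a ≡ −1`; then
Hoffstein–Luo for `E₁^{(u)}` with `S = {p, u}` gives `d''` with `(d''/p) = (d''/u) = 1`,
`L(E₁^{(u d'')}, 1) ≠ 0` and `a_p = −a ≢ 1 (mod p)` (`p > 2`); `d' = u d''`. In both cases `d'` is
square-free, `≡ 1 (mod 8)`, prime to `p`. [cite: HoffsteinLuo1997, Theorem (§1, pp. 435–436)]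
[cite: Knapp1993, Prop. 12.10] -/
theorem exists_goodOrd_rankZero_nonAnom_twist_of_typeGOrd
    (hHL : HoffsteinLuo1997_exists_twist_L_one_ne_zero)
    (hp5 : 5 ≤ p) (hG : TypeGOrd W p) (he : semistabilityIndex W p = 2) :
    ∃ (d' : ℤ) (Wd : WeierstrassCurve ℚ) (_ : Wd.IsElliptic) (_ : Wd.IsGloballyMinimal),
      Squarefree d' ∧ d' % 8 = 1 ∧ ¬ (p : ℤ) ∣ d' ∧
      (∃ C : VariableChange ℚ, C • W.quadraticTwist ((-1 : ℚ) ^ (p / 2) * p * d') = Wd) ∧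
      GoodOrd Wd p ∧ Wd.analyticRank = 0 ∧ ¬ (p : ℤ) ∣ Wd.frobeniusTrace p - 1 := by
  have hp2 : p ≠ 2 := by omega
  have hp1 : 1 < p := hp.out.one_lt
  obtain ⟨W₁, iW₁, iW₁m, C₁, hC₁, hord₁⟩ := exists_goodOrd_twist_pStar_of_typeGOrd W p hp5 hG he
  by_cases han : (p : ℤ) ∣ W₁.frobeniusTrace p - 1
  · -- anomalous `E^{(p*)}`: flip the sign of `a_p` with an auxiliary prime `u`, `(u/p) = −1`
    obtain ⟨u, hBu, hu, hu8, hJu⟩ := exists_prime_one_mod_eight_jacobiSym_eq {p}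
      (fun ℓ hℓ => by rw [Finset.mem_singleton.mp hℓ]; exact ⟨hp.out, hp2⟩) (fun _ => -1)
      (fun _ _ => Or.inr rfl) p
    have hJpu : jacobiSym (p : ℤ) u = -1 := hJu p (Finset.mem_singleton_self p)
    have hup : u ≠ p := by omega
    have hu2 : u ≠ 2 := by omega
    have husq : Squarefree (u : ℤ) := Int.squarefree_natCast.mpr hu.squarefree
    have hpu : ¬ (p : ℤ) ∣ (u : ℤ) := fun h =>
      hup ((Nat.prime_dvd_prime_iff_eq hp.out hu).mp (Int.natCast_dvd_natCast.mp h)).symm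
    have hlu : legendreSym p u = -1 := legendreSym_eq_neg_one_of_jacobiSym p (by omega) hp2 hJpu
    obtain ⟨W₂, iW₂, iW₂m, hC₂, hord₂, htr₂⟩ :=
      exists_twist_goodOrd_frobeniusTrace p W₁ hp2 hord₁ husq hpu
    -- Hoffstein–Luo for `W₂` with `S = {p, u}`
    obtain ⟨d'', hsq, hd8, -, hjac, hL⟩ := hHL.exists W₂ {p, u}
    have hj1 : jacobiSym d'' p = 1 :=
      hjac p (Finset.mem_insert_self p {u}) hp.out hp2
    have hju : jacobiSym d'' u = 1 :=
      hjac u (Finset.mem_insert_of_mem (Finset.mem_singleton_self u)) hu hu2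
    have hpd : ¬ (p : ℤ) ∣ d'' := by
      intro hdvd
      rw [jacobiSym.mod_left, Int.emod_eq_zero_of_dvd hdvd, jacobiSym.zero_left hp1] at hj1
      exact zero_ne_one hj1
    have hud : ¬ (u : ℤ) ∣ d'' := by
      intro hdvd
      rw [jacobiSym.mod_left, Int.emod_eq_zero_of_dvd hdvd, jacobiSym.zero_left hu.one_lt] at hju
      exact zero_ne_one hju
    haveI : Fact u.Prime := ⟨hu⟩
    have hld : legendreSym p d'' = 1 := by rw [jacobiSym.legendreSym.to_jacobiSym, hj1]
    obtain ⟨Wd, iWd, iWdm, hC₃, hord₃, htr₃⟩ :=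
      exists_twist_goodOrd_frobeniusTrace p W₂ hp2 hord₂ hsq hpd
    have hd0 : ((d'' : ℤ) : ℚ) ≠ 0 := by exact_mod_cast hsq.ne_zero
    haveI := W₂.isElliptic_quadraticTwist hd0
    refine ⟨u * d'', Wd, iWd, iWdm, ?_, ?_, ?_, ?_, hord₃, ?_, ?_⟩
    · -- square-free
      rw [← Int.squarefree_natAbs, Int.natAbs_mul, Int.natAbs_natCast, Nat.squarefree_mul_iff]
      exact ⟨(Nat.Prime.coprime_iff_not_dvd hu).mpr (fun h => hud (Int.natCast_dvd.mpr h)),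
        hu.squarefree, Int.squarefree_natAbs.mpr hsq⟩
    · have hu8Z : (u : ℤ) % 8 = 1 := by exact_mod_cast hu8
      rw [Int.mul_emod, hu8Z, hd8]; norm_num
    · intro h
      rcases (Nat.prime_iff_prime_int.mp hp.out).dvd_or_dvd h with h1 | h1
      · exact hpu h1
      · exact hpd h1
    · have h := exists_model_twist_mul W (exists_model_twist_mul W ⟨C₁, hC₁⟩ hC₂) hC₃
      push_cast
      rw [← mul_assoc]
      exact h
    · obtain ⟨C₃, hC₃'⟩ := hC₃
      rw [← hC₃', analyticRank_smul]
      exact Literature.NumberTheory.EllipticCurves.analyticRank_eq_zero_of_entireLFunction_one_ne_zero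
        _ hL
    · rw [htr₃, htr₂, hld, hlu, one_mul]
      intro h
      -- `(a − 1) + (−a − 1) = −2`, so `p ∣ 2`: impossible for `p ≥ 5`
      have h2 : (p : ℤ) ∣ 2 := by
        have h' : (p : ℤ) ∣ (W₁.frobeniusTrace p - 1) + (-1 * W₁.frobeniusTrace p - 1) :=
          dvd_add han h
        have hs : (W₁.frobeniusTrace p - 1) + (-1 * W₁.frobeniusTrace p - 1) = -2 := by ring
        rw [hs] at h'
        exact dvd_neg.mp h'
      have hle := Int.le_of_dvd two_pos h2
      omega
  · -- `E^{(p*)}` not anomalous: Hoffstein–Luo for `W₁` with `S = {p}`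
    obtain ⟨d', hsq, hd8, -, hjac, hL⟩ := hHL.exists W₁ {p}
    have hj1 : jacobiSym d' p = 1 := hjac p (Finset.mem_singleton_self p) hp.out hp2
    have hpd : ¬ (p : ℤ) ∣ d' := by
      intro hdvd
      rw [jacobiSym.mod_left, Int.emod_eq_zero_of_dvd hdvd, jacobiSym.zero_left hp1] at hj1
      exact zero_ne_one hj1
    have hld : legendreSym p d' = 1 := by rw [jacobiSym.legendreSym.to_jacobiSym, hj1]
    obtain ⟨Wd, iWd, iWdm, hC₂, hord₂, htr₂⟩ :=
      exists_twist_goodOrd_frobeniusTrace p W₁ hp2 hord₁ hsq hpd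
    have hd0 : ((d' : ℤ) : ℚ) ≠ 0 := by exact_mod_cast hsq.ne_zero
    haveI := W₁.isElliptic_quadraticTwist hd0
    refine ⟨d', Wd, iWd, iWdm, hsq, hd8, hpd, exists_model_twist_mul W ⟨C₁, hC₁⟩ hC₂, hord₂, ?_, ?_⟩
    · obtain ⟨C₂, hC₂'⟩ := hC₂
      rw [← hC₂', analyticRank_smul]
      exact Literature.NumberTheory.EllipticCurves.analyticRank_eq_zero_of_entireLFunction_one_ne_zero
        _ hL
    · rw [htr₂, hld, one_mul]
      exact han

end Supply

/-! ### X3♯(G-ord) ∩ `I₀*`: `BSD(E,p)` from the over-`K` input ALONE, for every pair -/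

section X3

variable (Wd : WeierstrassCurve ℚ) [Wd.IsElliptic] [Wd.IsGloballyMinimal]

omit [W.IsGloballyMinimal] in
/-- **Row C6 for a non-anomalous good ordinary twist of an X3 pair** (`p > 2`, `d ≠ 0`): reducible
(`red_of_model_twist`), good, not anomalous. [cite: CastellaGrossiSkinner2025, Thm. D (= 'Thm. 4')] -/
theorem rowC6_twist_of_classX3_of_not_dvd (hp2 : 2 < p) (hX : ClassX3 W p) {d : ℚ} (hd : d ≠ 0)
    (hWd : ∃ C : VariableChange ℚ, C • W.quadraticTwist d = Wd) (hord : GoodOrd Wd p)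
    (hna : ¬ (p : ℤ) ∣ Wd.frobeniusTrace p - 1) : RowC6 Wd p :=
  ⟨hp2, red_of_model_twist hd hWd hX.1, hord.1, fun h => hna h.2.2⟩

/-- **X3♯(G-ord) ∩ `I₀*`, `p ≥ 5`, `r_an(E) ≤ 1`: `BSD(E,p)` from the over-`K` input over the
quadratic fields RAMIFIED at `p` — for EVERY pair, with NO X1 input and NO datum on a twist.** If
`MissingPPartOverCAt (W.baseChange K) p` is granted for every quadratic `K` with `p ∣ d_K`, then
`BSD(E,p)`. Compared with gen 2/4 (`bsdp_of_classX3Gord_two_cases`: over-`K` input for `d_K = p*`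
AND the typed X1 input of the twist pair whenever `(E^{(p*)}, p) ∈ X1` — 243 of the 301 X3 `I₀*`
census pairs at N < 2·10⁴), the X1 branch is GONE: by the supply
(`exists_goodOrd_rankZero_nonAnom_twist_of_typeGOrd`) some twist `E^{(p*·d')}`, `p ∤ d'`, is good
ordinary, NOT anomalous and of analytic rank `0` at `p`, hence row C6 (Castella–Grossi–Skinner 2025
Thm. D with the Greenberg–Vatsal / Greenberg / Kato chain: `RowC6.bsdp`), and the descent runs over
`K = ℚ(√(p*·d'))` (Milne 1972 any-model, GZK, modularity: additive-p1's
`bsdp_of_pPartOverC_baseChange`). Same final shape as X4♯(G-ord) ∩ I₀*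
(`bsdp_of_classX4Gord_two_of_surj_of_forall_ramified`) and as additive-p1's X3♯(M)
(`bsdp_of_classX3M_of_forall_ramified`). The over-`K` input (there `E_K` is GOOD ORDINARY at the
RAMIFIED prime, `GordDescentField.lean`) is printed nowhere; X3♯(G-ord) stays CONSTRUCTION-SHAPED.
[cite: HoffsteinLuo1997, Theorem (§1, pp. 435–436)] [cite: CastellaGrossiSkinner2025, Thm. D (= 'Thm. 4')] -/
theorem bsdp_of_classX3Gord_two_of_forall_ramified
    (hCGS : CastellaGrossiSkinner2025.thmD_padicValRat_bsd_rank_le_one)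
    (hGV : GreenbergVatsal2000.thm13_charIdeal_eq_of_gvPar) (hGr : greenberg_charValue_rankZero)
    (hmod : hasEntireLFunction_rat) (hmodP : nonempty_modularParametrizationData)
    (hGZK : rank_eq_analyticRank_of_analyticRank_le_one)
    (hMilneC : Milne1972.bsdQuotient_baseChange_quadratic_anyModel)
    (hHL : HoffsteinLuo1997_exists_twist_L_one_ne_zero)
    (hp5 : 5 ≤ p) (hX : ClassX3Gord W p) (he : semistabilityIndex W p = 2)
    (hr : W.analyticRank ≤ 1)
    (hK : ∀ (K : Type) [Field K] [NumberField K], Module.finrank ℚ K = 2 →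
      (p : ℤ) ∣ NumberField.discr K → MissingPPartOverCAt (W.baseChange K) p) :
    BSDp W p := by
  have hp2 : p ≠ 2 := by omega
  obtain ⟨d', Wd, iWd, iWdm, hsq, hd8, hpd, ⟨C, hC⟩, hord, hr0, hna⟩ :=
    exists_goodOrd_rankZero_nonAnom_twist_of_typeGOrd W p hHL hp5 hX.typeGOrd he
  obtain ⟨K, iF, iN, h2, hdK⟩ := exists_quadraticField_discr_pStar_mul p hp2 hsq hd8 hpd
  have hdKQ : (NumberField.discr K : ℚ) = (-1 : ℚ) ^ (p / 2) * p * d' := by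
    rw [hdK]; push_cast; ring
  have hpdK : (p : ℤ) ∣ NumberField.discr K := by
    rw [hdK]; exact ⟨(-1 : ℤ) ^ (p / 2) * d', by ring⟩
  have hd0 : ((-1 : ℚ) ^ (p / 2) * p * d') ≠ 0 :=
    mul_ne_zero (pStar_ne_zero p) (by exact_mod_cast hsq.ne_zero)
  have hrd : Wd.analyticRank ≤ 1 := by rw [hr0]; exact zero_le_one
  have hbsd : BSDp Wd p := RowC6.bsdp hCGS hGV hGr hmod hmodP hGZK hrd
    (rowC6_twist_of_classX3_of_not_dvd W p Wd (by omega) hX.classX3 hd0 ⟨C, hC⟩ hord hna)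
  have hWdK : ∃ C : VariableChange ℚ, C • W.quadraticTwist (NumberField.discr K : ℚ) = Wd := by
    rw [hdKQ]; exact ⟨C, hC⟩
  exact bsdp_of_pPartOverC_baseChange W p K Wd hGZK hmod hMilneC hr h2 hWdK hrd (hK K h2 hpdK) hbsd

/-- The same with the plainer hypothesis "the `p`-part of BSD for `E` over EVERY quadratic field".
[cite: HoffsteinLuo1997, Theorem (§1, pp. 435–436)] [cite: CastellaGrossiSkinner2025, Thm. D (= 'Thm. 4')] -/
theorem bsdp_of_classX3Gord_two_of_forall_quadratic
    (hCGS : CastellaGrossiSkinner2025.thmD_padicValRat_bsd_rank_le_one)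
    (hGV : GreenbergVatsal2000.thm13_charIdeal_eq_of_gvPar) (hGr : greenberg_charValue_rankZero)
    (hmod : hasEntireLFunction_rat) (hmodP : nonempty_modularParametrizationData)
    (hGZK : rank_eq_analyticRank_of_analyticRank_le_one)
    (hMilneC : Milne1972.bsdQuotient_baseChange_quadratic_anyModel)
    (hHL : HoffsteinLuo1997_exists_twist_L_one_ne_zero)
    (hp5 : 5 ≤ p) (hX : ClassX3Gord W p) (he : semistabilityIndex W p = 2)
    (hr : W.analyticRank ≤ 1)
    (hK : ∀ (K : Type) [Field K] [NumberField K], Module.finrank ℚ K = 2 →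
      MissingPPartOverCAt (W.baseChange K) p) :
    BSDp W p :=
  bsdp_of_classX3Gord_two_of_forall_ramified W p hCGS hGV hGr hmod hmodP hGZK hMilneC hHL hp5 hX he hr
    (fun K _ _ h2 _ => hK K h2)

/-- The same in the Partition's `MissingPPartAt` / `Gord.MissingInputAt` currency.
[cite: HoffsteinLuo1997, Theorem (§1, pp. 435–436)] [cite: CastellaGrossiSkinner2025, Thm. D (= 'Thm. 4')] -/
theorem missingPPartAt_of_classX3Gord_two_of_forall_ramified
    (hCGS : CastellaGrossiSkinner2025.thmD_padicValRat_bsd_rank_le_one)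
    (hGV : GreenbergVatsal2000.thm13_charIdeal_eq_of_gvPar) (hGr : greenberg_charValue_rankZero)
    (hmod : hasEntireLFunction_rat) (hmodP : nonempty_modularParametrizationData)
    (hGZK : rank_eq_analyticRank_of_analyticRank_le_one)
    (hMilneC : Milne1972.bsdQuotient_baseChange_quadratic_anyModel)
    (hHL : HoffsteinLuo1997_exists_twist_L_one_ne_zero)
    (hp5 : 5 ≤ p) (hX : ClassX3Gord W p) (he : semistabilityIndex W p = 2)
    (hr : W.analyticRank ≤ 1)
    (hK : ∀ (K : Type) [Field K] [NumberField K], Module.finrank ℚ K = 2 →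
      (p : ℤ) ∣ NumberField.discr K → MissingPPartOverCAt (W.baseChange K) p) :
    MissingPPartAt W p := by
  haveI : Finite W.sha := (hGZK W hr).2
  exact missingPPartAt_of_bsdp W p (bsdp_of_classX3Gord_two_of_forall_ramified W p hCGS hGV hGr hmod
    hmodP hGZK hMilneC hHL hp5 hX he hr hK)

/-- **Exactness survives on X3**: for each quadratic `K` with a non-anomalous good ordinary twist
`E^{(d_K)}` of analytic rank `≤ 1` (e.g. the supplied one), `BSD(E,p) ⟺` the over-`K` input.
[cite: CastellaGrossiSkinner2025, Thm. D (= 'Thm. 4')] -/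
theorem bsdp_iff_overC_of_classX3_of_nonAnom_twist
    (hCGS : CastellaGrossiSkinner2025.thmD_padicValRat_bsd_rank_le_one)
    (hGV : GreenbergVatsal2000.thm13_charIdeal_eq_of_gvPar) (hGr : greenberg_charValue_rankZero)
    (hmod : hasEntireLFunction_rat) (hmodP : nonempty_modularParametrizationData)
    (hGZK : rank_eq_analyticRank_of_analyticRank_le_one)
    (hMilneC : Milne1972.bsdQuotient_baseChange_quadratic_anyModel)
    (hp2 : 2 < p) (hX : ClassX3 W p) (hr : W.analyticRank ≤ 1)
    (K : Type) [Field K] [NumberField K] (h2 : Module.finrank ℚ K = 2)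
    (hWd : ∃ C : VariableChange ℚ, C • W.quadraticTwist (NumberField.discr K : ℚ) = Wd)
    (hord : GoodOrd Wd p) (hrd : Wd.analyticRank ≤ 1) (hna : ¬ (p : ℤ) ∣ Wd.frobeniusTrace p - 1) :
    BSDp W p ↔ MissingPPartOverCAt (W.baseChange K) p := by
  have hd0 : (NumberField.discr K : ℚ) ≠ 0 := by exact_mod_cast NumberField.discr_ne_zero K
  have hbsd : BSDp Wd p := RowC6.bsdp hCGS hGV hGr hmod hmodP hGZK hrd
    (rowC6_twist_of_classX3_of_not_dvd W p Wd hp2 hX hd0 hWd hord hna)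
  exact (missingPPartOverCAt_baseChange_iff_bsdp W p K Wd hGZK hmod hMilneC hr h2 hWd hrd hbsd).symm

/-- **Existence of an EXACT descent field for every X3♯(G-ord) ∩ `I₀*` pair** (`p ≥ 5`,
`r_an(E) ≤ 1`; Hoffstein–Luo): a quadratic `K` with `p ∣ d_K` and
`BSD(E,p) ⟺ MissingPPartOverCAt (W.baseChange K) p` — twin of additive-p1's
`ClassX3M.exists_quadraticField_bsdp_iff`. [cite: HoffsteinLuo1997, Theorem (§1, pp. 435–436)]
[cite: CastellaGrossiSkinner2025, Thm. D (= 'Thm. 4')] -/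
theorem ClassX3Gord.exists_quadraticField_bsdp_iff
    (hCGS : CastellaGrossiSkinner2025.thmD_padicValRat_bsd_rank_le_one)
    (hGV : GreenbergVatsal2000.thm13_charIdeal_eq_of_gvPar) (hGr : greenberg_charValue_rankZero)
    (hmod : hasEntireLFunction_rat) (hmodP : nonempty_modularParametrizationData)
    (hGZK : rank_eq_analyticRank_of_analyticRank_le_one)
    (hMilneC : Milne1972.bsdQuotient_baseChange_quadratic_anyModel)
    (hHL : HoffsteinLuo1997_exists_twist_L_one_ne_zero)
    (hp5 : 5 ≤ p) (hX : ClassX3Gord W p) (he : semistabilityIndex W p = 2)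
    (hr : W.analyticRank ≤ 1) :
    ∃ (K : Type) (_ : Field K) (_ : NumberField K), Module.finrank ℚ K = 2 ∧
      (p : ℤ) ∣ NumberField.discr K ∧ (BSDp W p ↔ MissingPPartOverCAt (W.baseChange K) p) := by
  have hp2 : p ≠ 2 := by omega
  obtain ⟨d', Wd, iWd, iWdm, hsq, hd8, hpd, ⟨C, hC⟩, hord, hr0, hna⟩ :=
    exists_goodOrd_rankZero_nonAnom_twist_of_typeGOrd W p hHL hp5 hX.typeGOrd he
  obtain ⟨K, iF, iN, h2, hdK⟩ := exists_quadraticField_discr_pStar_mul p hp2 hsq hd8 hpd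
  have hdKQ : (NumberField.discr K : ℚ) = (-1 : ℚ) ^ (p / 2) * p * d' := by
    rw [hdK]; push_cast; ring
  have hpdK : (p : ℤ) ∣ NumberField.discr K := by
    rw [hdK]; exact ⟨(-1 : ℤ) ^ (p / 2) * d', by ring⟩
  have hWdK : ∃ C : VariableChange ℚ, C • W.quadraticTwist (NumberField.discr K : ℚ) = Wd := by
    rw [hdKQ]; exact ⟨C, hC⟩
  have hrd : Wd.analyticRank ≤ 1 := by rw [hr0]; exact zero_le_one
  exact ⟨K, iF, iN, h2, hpdK, bsdp_iff_overC_of_classX3_of_nonAnom_twist W p Wd hCGS hGV hGr hmod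
    hmodP hGZK hMilneC (by omega) hX.classX3 hr K h2 hWdK hord hrd hna⟩

end X3

end Summit.BirchSwinnertonDyer.Rank1Residual.Additive

end
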